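import Mathlib
import Summits.MatrixMultiplication.MatrixMultiplication.Theorems.SubgroupIdentityDesigns.Negative.LineCertificate
import Summits.MatrixMultiplication.MatrixMultiplication.Theorems.SubgroupIdentityDesigns.Negative.EndPlacements

/-!
# A line-transitive member kills the triple (all `p`)

Route `LevelGradedCohnUmans`, crux `SubgroupIdentityDesigns` (stmt-MatrixMultiplication-14079), the
`(m,k) = (2,1)` cell.  VALUE = THEOREM (all `p`), NOT summit progress; the crux item is untouched and
remains open.

Let `(H₁, H₂, H₃)` be subgroup-TPP in `GL₂(𝔽_p)` with scalar parts covering the centre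
(`S₁S₂S₃ = Z`; automatic when `|S₁||S₂||S₃| = p - 1`, `scalar_cover`).  If one member `E` acts
TRANSITIVELY ON THE LINES of `𝔽_p²` (`∀ v w ≠ 0, ∃ e ∈ E, e v ∈ 𝔽_p w`) and another member contains a
NON-SCALAR element `h`, then the triple carries no level-`1` identity design
(`no_levelOne_design_of_lineTransitive₁₂`: `E = H₁`, `h ∈ H₂`; `₂₃`: `E = H₂`, `h ∈ H₃`;
`₃₂`: `E = H₃`, `h ∈ H₂`, by reversal).  Mechanism (`LineCertificate.lean`): the two-coset weight
`[k = 1] - [k = h]` has equal LINE counts `#{b ⬝ (h₁ k h₃ u) = 0}` at `k = 1` and `k = h`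
(`lineCount_eq_of_lineTransitive`: re-index the transitive member), and by TPP + the scalar cover a
triple product `h₁ h h₃` is never scalar.  Compare `TransitiveTorus.lean`, which needs a member
transitive on the non-zero VECTORS (a full Singer cycle); here `|E|` may be as small as `2(p+1)`.
-/

set_option linter.dupNamespace false

noncomputable section

open scoped BigOperators Classical

open Summit.MatrixMultiplication.MatrixMultiplication.Theorems.LieRankDesigns.Negative (GLm Mat)

namespace Summit.MatrixMultiplication.MatrixMultiplication.Theorems.SubgroupIdentityDesigns.Negative

section LineTransitiveMember

open Literature.Barriers.MatrixMultiplication (SubgroupTPP)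

variable {p : ℕ} [hp : Fact p.Prime]

/-- **Line counts do not see the vector, only that it is non-zero**, when `H` is transitive on
lines: `#{h ∈ H : b ⬝ (h v) = 0} = #{h ∈ H : b ⬝ (h w) = 0}` for `v, w ≠ 0`. -/
theorem lineCount_eq_of_lineTransitive {H : Subgroup (GLm p 2)}
    (htrans : ∀ v w : Fin 2 → ZMod p, v ≠ 0 → w ≠ 0 →
      ∃ g ∈ H, ∃ ν : ZMod p, ((g : GLm p 2) : Mat p 2).mulVec v = ν • w)
    (b : Fin 2 → ZMod p) {v w : Fin 2 → ZMod p} (hv : v ≠ 0) (hw : w ≠ 0) :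
    (∑ h : H, if b ⬝ᵥ ((h : GLm p 2) : Mat p 2).mulVec v = 0 then (1 : ℂ) else 0) =
      ∑ h : H, if b ⬝ᵥ ((h : GLm p 2) : Mat p 2).mulVec w = 0 then (1 : ℂ) else 0 := by
  obtain ⟨g, hg, ν, hgv⟩ := htrans v w hv hw
  have hν : ν ≠ 0 := by
    rintro rfl
    rw [zero_smul] at hgv
    exact gl2_mulVec_ne_zero g hv hgv
  rw [← Fintype.sum_equiv (Equiv.mulRight (⟨g, hg⟩ : H))
    (fun h : H => if b ⬝ᵥ (((h * ⟨g, hg⟩ : H) : GLm p 2) : Mat p 2).mulVec v = 0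
      then (1 : ℂ) else 0)
    (fun h : H => if b ⬝ᵥ ((h : GLm p 2) : Mat p 2).mulVec v = 0 then (1 : ℂ) else 0)
    (fun _ => rfl)]
  refine Finset.sum_congr rfl fun h _ => ?_
  have e : (((h * ⟨g, hg⟩ : H) : GLm p 2) : Mat p 2).mulVec v =
      ν • ((h : GLm p 2) : Mat p 2).mulVec w := by
    rw [Subgroup.coe_mul, Units.val_mul, ← Matrix.mulVec_mulVec, hgv, Matrix.mulVec_smul]
  have e' : b ⬝ᵥ (((h * ⟨g, hg⟩ : H) : GLm p 2) : Mat p 2).mulVec v = 0 ↔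
      b ⬝ᵥ ((h : GLm p 2) : Mat p 2).mulVec w = 0 := by
    rw [e, dotProduct_smul, smul_eq_mul, mul_eq_zero, or_iff_right hν]
  simp only [e']

/-- By TPP and the scalar cover, a triple product with a non-scalar middle factor is not scalar. -/
theorem triple_not_mem_range_scalarHom {H₁ H₂ H₃ : Subgroup (GLm p 2)}
    (htpp : SubgroupTPP H₁ H₂ H₃)
    (hZ : ∀ z ∈ (scalarHom p 2).range, ∃ s₁ ∈ H₁ ⊓ (scalarHom p 2).range,
      ∃ s₂ ∈ H₂ ⊓ (scalarHom p 2).range, ∃ s₃ ∈ H₃ ⊓ (scalarHom p 2).range, s₁ * s₂ * s₃ = z)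
    {h₁ h h₃ : GLm p 2} (hh₁ : h₁ ∈ H₁) (hh : h ∈ H₂) (hh₃ : h₃ ∈ H₃)
    (hhZ : h ∉ (scalarHom p 2).range) : h₁ * h * h₃ ∉ (scalarHom p 2).range := by
  intro hmem
  obtain ⟨s₁, hs₁, s₂, hs₂, s₃, hs₃, hprod⟩ := hZ _ hmem
  obtain ⟨hs₁H, u₁, rfl⟩ := Subgroup.mem_inf.mp hs₁
  obtain ⟨hs₂H, u₂, rfl⟩ := Subgroup.mem_inf.mp hs₂
  obtain ⟨hs₃H, u₃, rfl⟩ := Subgroup.mem_inf.mp hs₃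
  have e : (scalarHom p 2 u₁)⁻¹ * h₁ * ((scalarHom p 2 u₂)⁻¹ * h) *
      ((scalarHom p 2 u₃)⁻¹ * h₃) = 1 := by
    rw [← map_inv, ← map_inv, ← map_inv, scalarHom_triple_mul, ← hprod, ← map_mul, ← map_mul,
      ← map_mul, ← map_mul, ← mul_inv, ← mul_inv, ← map_mul, inv_mul_cancel, map_one]
  have h2 := (htpp _ (H₁.mul_mem (H₁.inv_mem hs₁H) hh₁) _ (H₂.mul_mem (H₂.inv_mem hs₂H) hh) _
    (H₃.mul_mem (H₃.inv_mem hs₃H) hh₃) e).2.1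
  rw [inv_mul_eq_one] at h2
  exact hhZ ⟨u₂, h2⟩

/-- The two-coset weight `[k = 1] - [k = h]` on the middle member collapses the `k`-sum. -/
theorem sum_twoCoset_weight {H₁ H₂ H₃ : Subgroup (GLm p 2)} {h : GLm p 2} (hh : h ∈ H₂)
    (h1 : h ≠ 1) (ψ : GLm p 2 → GLm p 2 → GLm p 2 → ℂ) :
    (∑ h₁ : H₁, ∑ k : H₂, ∑ h₃ : H₃,
        (if (k : GLm p 2) = 1 then (1 : ℂ) else if (k : GLm p 2) = h then -1 else 0) *
          ψ h₁ k h₃) =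
      (∑ h₁ : H₁, ∑ h₃ : H₃, ψ h₁ 1 h₃) - ∑ h₁ : H₁, ∑ h₃ : H₃, ψ h₁ h h₃ := by
  have hne : (1 : H₂) ≠ ⟨h, hh⟩ := fun e => h1 (congrArg Subtype.val e).symm
  rw [Finset.sum_comm, Fintype.sum_eq_add (1 : H₂) ⟨h, hh⟩ hne]
  · simp only [OneMemClass.coe_one, if_true, one_mul, h1, if_false, neg_one_mul,
      Finset.sum_neg_distrib, sub_eq_add_neg]
  · rintro k ⟨hk1, hkh⟩
    have hk1' : (k : GLm p 2) ≠ 1 := fun e => hk1 (Subtype.ext e)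
    have hkh' : (k : GLm p 2) ≠ h := fun e => hkh (Subtype.ext e)
    simp only [hk1', hkh', if_false, zero_mul, Finset.sum_const_zero]

/-- **LINE-TRANSITIVE FIRST MEMBER + NON-SCALAR ELEMENT OF THE SECOND ⇒ NO DESIGN.**  All `p`. -/
theorem no_levelOne_design_of_lineTransitive₁₂ {H₁ H₂ H₃ : Subgroup (GLm p 2)}
    (htpp : SubgroupTPP H₁ H₂ H₃)
    (hZ : ∀ z ∈ (scalarHom p 2).range, ∃ s₁ ∈ H₁ ⊓ (scalarHom p 2).range,
      ∃ s₂ ∈ H₂ ⊓ (scalarHom p 2).range, ∃ s₃ ∈ H₃ ⊓ (scalarHom p 2).range, s₁ * s₂ * s₃ = z)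
    (htrans : ∀ v w : Fin 2 → ZMod p, v ≠ 0 → w ≠ 0 →
      ∃ g ∈ H₁, ∃ ν : ZMod p, ((g : GLm p 2) : Mat p 2).mulVec v = ν • w)
    {h : GLm p 2} (hh : h ∈ H₂) (hhZ : h ∉ (scalarHom p 2).range) :
    ¬ ∃ c : Mat p 2 → ℂ, (∀ M, 1 < M.rank → c M = 0) ∧
      (∑ M, c M * ZMod.stdAddChar (Matrix.trace (M * ((1 : GLm p 2) : Mat p 2)))) = 1 ∧
      ∀ a ∈ H₁, ∀ b ∈ H₂, ∀ g ∈ H₃, a * b * g ≠ 1 →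
        (∑ M, c M *
          ZMod.stdAddChar (Matrix.trace (M * ((a * b * g : GLm p 2) : Mat p 2)))) = 0 := by
  have h1 : h ≠ 1 := fun e => hhZ (e ▸ (scalarHom p 2).range.one_mem)
  -- move the weight out of the indicator
  have hite : ∀ (P : Prop) [Decidable P] (k : GLm p 2),
      (if P then (if k = 1 then (1 : ℂ) else if k = h then -1 else 0) else 0) =
        (if k = 1 then (1 : ℂ) else if k = h then -1 else 0) * (if P then 1 else 0) := by
    intro P _ k
    split_ifs <;> simp
  refine no_levelOne_design_of_line_certificate hZ
    (fun _ k _ => if k = 1 then 1 else if k = h then -1 else 0) ?_ ?_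
  · -- (ii) the scalar triples: only `k = 1` contributes, and `(1,1,1)` does
    have key := sum_twoCoset_weight (H₁ := H₁) (H₃ := H₃) hh h1
      (fun h₁ k h₃ => if (h₁ * k * h₃ : GLm p 2) ∈ (scalarHom p 2).range then (1 : ℂ) else 0)
    beta_reduce at key
    simp_rw [hite]
    rw [key]
    have hzero : (∑ h₁ : H₁, ∑ h₃ : H₃,
        if ((h₁ : GLm p 2) * h * h₃ : GLm p 2) ∈ (scalarHom p 2).range then (1 : ℂ) else 0) = 0 :=
      Finset.sum_eq_zero fun h₁ _ => Finset.sum_eq_zero fun h₃ _ =>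
        if_neg (triple_not_mem_range_scalarHom htpp hZ h₁.2 hh h₃.2 hhZ)
    rw [hzero, sub_zero]
    have hcast : (∑ h₁ : H₁, ∑ h₃ : H₃,
        if ((h₁ : GLm p 2) * 1 * h₃ : GLm p 2) ∈ (scalarHom p 2).range then (1 : ℂ) else 0) =
        ((∑ h₁ : H₁, ∑ h₃ : H₃,
          if ((h₁ : GLm p 2) * 1 * h₃ : GLm p 2) ∈ (scalarHom p 2).range then 1 else 0 : ℕ) : ℂ) := by
      push_cast
      rfl
    rw [hcast, Nat.cast_ne_zero, ← Nat.pos_iff_ne_zero]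
    calc 0 < (if (((1 : H₁) : GLm p 2) * 1 * ((1 : H₃) : GLm p 2) : GLm p 2) ∈ (scalarHom p 2).range
          then 1 else 0 : ℕ) := by
          rw [OneMemClass.coe_one, OneMemClass.coe_one, mul_one, mul_one,
            if_pos (scalarHom p 2).range.one_mem]
          exact Nat.one_pos
      _ ≤ ∑ h₃ : H₃, (if (((1 : H₁) : GLm p 2) * 1 * (h₃ : GLm p 2) : GLm p 2) ∈
            (scalarHom p 2).range then 1 else 0 : ℕ) :=
          Finset.single_le_sum (f := fun h₃ : H₃ => (if (((1 : H₁) : GLm p 2) * 1 *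
            (h₃ : GLm p 2) : GLm p 2) ∈ (scalarHom p 2).range then 1 else 0 : ℕ))
            (fun _ _ => Nat.zero_le _) (Finset.mem_univ (1 : H₃))
      _ ≤ ∑ h₁ : H₁, ∑ h₃ : H₃, (if ((h₁ : GLm p 2) * 1 * (h₃ : GLm p 2) : GLm p 2) ∈
            (scalarHom p 2).range then 1 else 0 : ℕ) :=
          Finset.single_le_sum (f := fun h₁ : H₁ => ∑ h₃ : H₃, (if ((h₁ : GLm p 2) * 1 *
            (h₃ : GLm p 2) : GLm p 2) ∈ (scalarHom p 2).range then 1 else 0 : ℕ))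
            (fun _ _ => Nat.zero_le _) (Finset.mem_univ (1 : H₁))
  · -- (i) the line counts: `k = 1` and `k = h` see the same counts
    intro u b
    have key := sum_twoCoset_weight (H₁ := H₁) (H₃ := H₃) hh h1
      (fun h₁ k h₃ => if b ⬝ᵥ ((h₁ * k * h₃ : GLm p 2) : Mat p 2).mulVec u = 0
        then (1 : ℂ) else 0)
    beta_reduce at key
    simp_rw [hite]
    rw [key, sub_eq_zero]
    -- per `h₃`, the `h₁`-counts agree
    have hN : ∀ h₃ : H₃, (∑ h₁ : H₁,
        if b ⬝ᵥ (((h₁ : GLm p 2) * 1 * h₃ : GLm p 2) : Mat p 2).mulVec u = 0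
          then (1 : ℂ) else 0) =
        ∑ h₁ : H₁, if b ⬝ᵥ (((h₁ : GLm p 2) * h * h₃ : GLm p 2) : Mat p 2).mulVec u = 0
          then (1 : ℂ) else 0 := by
      intro h₃
      have e1 : ∀ h₁ : H₁, (((h₁ : GLm p 2) * 1 * h₃ : GLm p 2) : Mat p 2).mulVec u =
          ((h₁ : GLm p 2) : Mat p 2).mulVec (((h₃ : GLm p 2) : Mat p 2).mulVec u) := by
        intro h₁
        rw [mul_one, Units.val_mul, ← Matrix.mulVec_mulVec]
      have e2 : ∀ h₁ : H₁, (((h₁ : GLm p 2) * h * h₃ : GLm p 2) : Mat p 2).mulVec u =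
          ((h₁ : GLm p 2) : Mat p 2).mulVec (((h * h₃ : GLm p 2) : Mat p 2).mulVec u) := by
        intro h₁
        rw [mul_assoc, Units.val_mul, ← Matrix.mulVec_mulVec]
      simp only [e1, e2]
      by_cases hu : u = 0
      · simp only [hu, Matrix.mulVec_zero]
      · exact lineCount_eq_of_lineTransitive htrans b (gl2_mulVec_ne_zero _ hu)
          (gl2_mulVec_ne_zero _ hu)
    calc (∑ h₁ : H₁, ∑ h₃ : H₃,
          if b ⬝ᵥ (((h₁ : GLm p 2) * 1 * h₃ : GLm p 2) : Mat p 2).mulVec u = 0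
            then (1 : ℂ) else 0)
        = ∑ h₃ : H₃, ∑ h₁ : H₁,
            if b ⬝ᵥ (((h₁ : GLm p 2) * 1 * h₃ : GLm p 2) : Mat p 2).mulVec u = 0
              then (1 : ℂ) else 0 := Finset.sum_comm
      _ = ∑ h₃ : H₃, ∑ h₁ : H₁,
            if b ⬝ᵥ (((h₁ : GLm p 2) * h * h₃ : GLm p 2) : Mat p 2).mulVec u = 0
              then (1 : ℂ) else 0 := Finset.sum_congr rfl fun h₃ _ => hN h₃
      _ = ∑ h₁ : H₁, ∑ h₃ : H₃,
            if b ⬝ᵥ (((h₁ : GLm p 2) * h * h₃ : GLm p 2) : Mat p 2).mulVec u = 0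
              then (1 : ℂ) else 0 := Finset.sum_comm

/-- By TPP and the scalar cover, a triple product with a non-scalar last factor is not scalar. -/
theorem triple_not_mem_range_scalarHom₃ {H₁ H₂ H₃ : Subgroup (GLm p 2)}
    (htpp : SubgroupTPP H₁ H₂ H₃)
    (hZ : ∀ z ∈ (scalarHom p 2).range, ∃ s₁ ∈ H₁ ⊓ (scalarHom p 2).range,
      ∃ s₂ ∈ H₂ ⊓ (scalarHom p 2).range, ∃ s₃ ∈ H₃ ⊓ (scalarHom p 2).range, s₁ * s₂ * s₃ = z)
    {h₁ k h : GLm p 2} (hh₁ : h₁ ∈ H₁) (hk : k ∈ H₂) (hh : h ∈ H₃)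
    (hhZ : h ∉ (scalarHom p 2).range) : h₁ * k * h ∉ (scalarHom p 2).range := by
  intro hmem
  obtain ⟨s₁, hs₁, s₂, hs₂, s₃, hs₃, hprod⟩ := hZ _ hmem
  obtain ⟨hs₁H, u₁, rfl⟩ := Subgroup.mem_inf.mp hs₁
  obtain ⟨hs₂H, u₂, rfl⟩ := Subgroup.mem_inf.mp hs₂
  obtain ⟨hs₃H, u₃, rfl⟩ := Subgroup.mem_inf.mp hs₃
  have e : (scalarHom p 2 u₁)⁻¹ * h₁ * ((scalarHom p 2 u₂)⁻¹ * k) *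
      ((scalarHom p 2 u₃)⁻¹ * h) = 1 := by
    rw [← map_inv, ← map_inv, ← map_inv, scalarHom_triple_mul, ← hprod, ← map_mul, ← map_mul,
      ← map_mul, ← map_mul, ← mul_inv, ← mul_inv, ← map_mul, inv_mul_cancel, map_one]
  have h2 := (htpp _ (H₁.mul_mem (H₁.inv_mem hs₁H) hh₁) _ (H₂.mul_mem (H₂.inv_mem hs₂H) hk) _
    (H₃.mul_mem (H₃.inv_mem hs₃H) hh) e).2.2
  rw [inv_mul_eq_one] at h2
  exact hhZ ⟨u₃, h2⟩

/-- The two-coset weight `[h₃ = 1] - [h₃ = h]` on the last member collapses the `h₃`-sum. -/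
theorem sum_twoCoset_weight₃ {H₁ H₂ H₃ : Subgroup (GLm p 2)} {h : GLm p 2} (hh : h ∈ H₃)
    (h1 : h ≠ 1) (ψ : GLm p 2 → GLm p 2 → GLm p 2 → ℂ) :
    (∑ h₁ : H₁, ∑ k : H₂, ∑ h₃ : H₃,
        (if (h₃ : GLm p 2) = 1 then (1 : ℂ) else if (h₃ : GLm p 2) = h then -1 else 0) *
          ψ h₁ k h₃) =
      (∑ h₁ : H₁, ∑ k : H₂, ψ h₁ k 1) - ∑ h₁ : H₁, ∑ k : H₂, ψ h₁ k h := by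
  have hne : (1 : H₃) ≠ ⟨h, hh⟩ := fun e => h1 (congrArg Subtype.val e).symm
  have inner : ∀ (h₁ : H₁) (k : H₂), (∑ h₃ : H₃,
      (if (h₃ : GLm p 2) = 1 then (1 : ℂ) else if (h₃ : GLm p 2) = h then -1 else 0) *
        ψ h₁ k h₃) = ψ h₁ k 1 - ψ h₁ k h := by
    intro h₁ k
    rw [Fintype.sum_eq_add (1 : H₃) ⟨h, hh⟩ hne]
    · simp only [OneMemClass.coe_one, if_true, one_mul, h1, if_false, neg_one_mul,
        sub_eq_add_neg]
    · rintro h₃ ⟨hk1, hkh⟩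
      have hk1' : (h₃ : GLm p 2) ≠ 1 := fun e => hk1 (Subtype.ext e)
      have hkh' : (h₃ : GLm p 2) ≠ h := fun e => hkh (Subtype.ext e)
      simp only [hk1', hkh', if_false, zero_mul]
  simp only [inner, Finset.sum_sub_distrib]

/-- **LINE-TRANSITIVE SECOND MEMBER + NON-SCALAR ELEMENT OF THE THIRD ⇒ NO DESIGN.**  All `p`. -/
theorem no_levelOne_design_of_lineTransitive₂₃ {H₁ H₂ H₃ : Subgroup (GLm p 2)}
    (htpp : SubgroupTPP H₁ H₂ H₃)
    (hZ : ∀ z ∈ (scalarHom p 2).range, ∃ s₁ ∈ H₁ ⊓ (scalarHom p 2).range,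
      ∃ s₂ ∈ H₂ ⊓ (scalarHom p 2).range, ∃ s₃ ∈ H₃ ⊓ (scalarHom p 2).range, s₁ * s₂ * s₃ = z)
    (htrans : ∀ v w : Fin 2 → ZMod p, v ≠ 0 → w ≠ 0 →
      ∃ g ∈ H₂, ∃ ν : ZMod p, ((g : GLm p 2) : Mat p 2).mulVec v = ν • w)
    {h : GLm p 2} (hh : h ∈ H₃) (hhZ : h ∉ (scalarHom p 2).range) :
    ¬ ∃ c : Mat p 2 → ℂ, (∀ M, 1 < M.rank → c M = 0) ∧
      (∑ M, c M * ZMod.stdAddChar (Matrix.trace (M * ((1 : GLm p 2) : Mat p 2)))) = 1 ∧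
      ∀ a ∈ H₁, ∀ b ∈ H₂, ∀ g ∈ H₃, a * b * g ≠ 1 →
        (∑ M, c M *
          ZMod.stdAddChar (Matrix.trace (M * ((a * b * g : GLm p 2) : Mat p 2)))) = 0 := by
  have h1 : h ≠ 1 := fun e => hhZ (e ▸ (scalarHom p 2).range.one_mem)
  have hite : ∀ (P : Prop) [Decidable P] (k : GLm p 2),
      (if P then (if k = 1 then (1 : ℂ) else if k = h then -1 else 0) else 0) =
        (if k = 1 then (1 : ℂ) else if k = h then -1 else 0) * (if P then 1 else 0) := by
    intro P _ k
    split_ifs <;> simp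
  refine no_levelOne_design_of_line_certificate hZ
    (fun _ _ k => if k = 1 then 1 else if k = h then -1 else 0) ?_ ?_
  · -- (ii)
    have key := sum_twoCoset_weight₃ (H₁ := H₁) (H₂ := H₂) hh h1
      (fun h₁ k h₃ => if (h₁ * k * h₃ : GLm p 2) ∈ (scalarHom p 2).range then (1 : ℂ) else 0)
    beta_reduce at key
    simp_rw [hite]
    rw [key]
    have hzero : (∑ h₁ : H₁, ∑ k : H₂,
        if ((h₁ : GLm p 2) * k * h : GLm p 2) ∈ (scalarHom p 2).range then (1 : ℂ) else 0) = 0 :=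
      Finset.sum_eq_zero fun h₁ _ => Finset.sum_eq_zero fun k _ =>
        if_neg (triple_not_mem_range_scalarHom₃ htpp hZ h₁.2 k.2 hh hhZ)
    rw [hzero, sub_zero]
    have hcast : (∑ h₁ : H₁, ∑ k : H₂,
        if ((h₁ : GLm p 2) * k * 1 : GLm p 2) ∈ (scalarHom p 2).range then (1 : ℂ) else 0) =
        ((∑ h₁ : H₁, ∑ k : H₂,
          if ((h₁ : GLm p 2) * k * 1 : GLm p 2) ∈ (scalarHom p 2).range then 1 else 0 : ℕ) : ℂ) := by
      push_cast
      rfl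
    rw [hcast, Nat.cast_ne_zero, ← Nat.pos_iff_ne_zero]
    calc 0 < (if (((1 : H₁) : GLm p 2) * ((1 : H₂) : GLm p 2) * 1 : GLm p 2) ∈ (scalarHom p 2).range
          then 1 else 0 : ℕ) := by
          rw [OneMemClass.coe_one, OneMemClass.coe_one, mul_one, mul_one,
            if_pos (scalarHom p 2).range.one_mem]
          exact Nat.one_pos
      _ ≤ ∑ k : H₂, (if (((1 : H₁) : GLm p 2) * (k : GLm p 2) * 1 : GLm p 2) ∈
            (scalarHom p 2).range then 1 else 0 : ℕ) :=
          Finset.single_le_sum (f := fun k : H₂ => (if (((1 : H₁) : GLm p 2) * (k : GLm p 2) *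
            1 : GLm p 2) ∈ (scalarHom p 2).range then 1 else 0 : ℕ))
            (fun _ _ => Nat.zero_le _) (Finset.mem_univ (1 : H₂))
      _ ≤ ∑ h₁ : H₁, ∑ k : H₂, (if ((h₁ : GLm p 2) * (k : GLm p 2) * 1 : GLm p 2) ∈
            (scalarHom p 2).range then 1 else 0 : ℕ) :=
          Finset.single_le_sum (f := fun h₁ : H₁ => ∑ k : H₂, (if ((h₁ : GLm p 2) * (k : GLm p 2) *
            1 : GLm p 2) ∈ (scalarHom p 2).range then 1 else 0 : ℕ))
            (fun _ _ => Nat.zero_le _) (Finset.mem_univ (1 : H₁))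
  · -- (i): for fixed `h₁`, `b ⬝ (h₁ k x) = (b h₁) ⬝ (k x)` and `H₂` is line-transitive
    intro u b
    have key := sum_twoCoset_weight₃ (H₁ := H₁) (H₂ := H₂) hh h1
      (fun h₁ k h₃ => if b ⬝ᵥ ((h₁ * k * h₃ : GLm p 2) : Mat p 2).mulVec u = 0
        then (1 : ℂ) else 0)
    beta_reduce at key
    simp_rw [hite]
    rw [key, sub_eq_zero]
    refine Finset.sum_congr rfl fun h₁ _ => ?_
    have e1 : ∀ k : H₂, (((h₁ : GLm p 2) * k * 1 : GLm p 2) : Mat p 2).mulVec u =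
        ((h₁ : GLm p 2) : Mat p 2).mulVec (((k : GLm p 2) : Mat p 2).mulVec u) := by
      intro k
      rw [mul_one, Units.val_mul, ← Matrix.mulVec_mulVec]
    have e2 : ∀ k : H₂, (((h₁ : GLm p 2) * k * h : GLm p 2) : Mat p 2).mulVec u =
        ((h₁ : GLm p 2) : Mat p 2).mulVec (((k : GLm p 2) : Mat p 2).mulVec
          ((h : Mat p 2).mulVec u)) := by
      intro k
      rw [Units.val_mul, Units.val_mul, ← Matrix.mulVec_mulVec, ← Matrix.mulVec_mulVec]
    simp only [e1, e2]
    have e3 : ∀ x : Fin 2 → ZMod p, b ⬝ᵥ ((h₁ : GLm p 2) : Mat p 2).mulVec x =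
        Matrix.vecMul b ((h₁ : GLm p 2) : Mat p 2) ⬝ᵥ x := fun x => Matrix.dotProduct_mulVec _ _ _
    simp only [e3]
    by_cases hu : u = 0
    · simp only [hu, Matrix.mulVec_zero]
    · exact lineCount_eq_of_lineTransitive htrans _ hu (gl2_mulVec_ne_zero _ hu)

/-- **LINE-TRANSITIVE THIRD MEMBER + NON-SCALAR ELEMENT OF THE SECOND ⇒ NO DESIGN** (by reversal
`(H₁,H₂,H₃) ↦ (H₃,H₂,H₁)`, `Reversal.design_reverse`).  All `p`. -/
theorem no_levelOne_design_of_lineTransitive₃₂ {H₁ H₂ H₃ : Subgroup (GLm p 2)}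
    (htpp : SubgroupTPP H₁ H₂ H₃)
    (hZ : ∀ z ∈ (scalarHom p 2).range, ∃ s₁ ∈ H₁ ⊓ (scalarHom p 2).range,
      ∃ s₂ ∈ H₂ ⊓ (scalarHom p 2).range, ∃ s₃ ∈ H₃ ⊓ (scalarHom p 2).range, s₁ * s₂ * s₃ = z)
    (htrans : ∀ v w : Fin 2 → ZMod p, v ≠ 0 → w ≠ 0 →
      ∃ g ∈ H₃, ∃ ν : ZMod p, ((g : GLm p 2) : Mat p 2).mulVec v = ν • w)
    {h : GLm p 2} (hh : h ∈ H₂) (hhZ : h ∉ (scalarHom p 2).range) :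
    ¬ ∃ c : Mat p 2 → ℂ, (∀ M, 1 < M.rank → c M = 0) ∧
      (∑ M, c M * ZMod.stdAddChar (Matrix.trace (M * ((1 : GLm p 2) : Mat p 2)))) = 1 ∧
      ∀ a ∈ H₁, ∀ b ∈ H₂, ∀ g ∈ H₃, a * b * g ≠ 1 →
        (∑ M, c M *
          ZMod.stdAddChar (Matrix.trace (M * ((a * b * g : GLm p 2) : Mat p 2)))) = 0 := by
  intro hdes
  have hZ' : ∀ z ∈ (scalarHom p 2).range, ∃ s₁ ∈ H₃ ⊓ (scalarHom p 2).range,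
      ∃ s₂ ∈ H₂ ⊓ (scalarHom p 2).range, ∃ s₃ ∈ H₁ ⊓ (scalarHom p 2).range, s₁ * s₂ * s₃ = z := by
    intro z hz
    obtain ⟨s₁, hs₁, s₂, hs₂, s₃, hs₃, hprod⟩ := hZ z hz
    obtain ⟨hs₁H, u₁, rfl⟩ := Subgroup.mem_inf.mp hs₁
    obtain ⟨hs₂H, u₂, rfl⟩ := Subgroup.mem_inf.mp hs₂
    obtain ⟨hs₃H, u₃, rfl⟩ := Subgroup.mem_inf.mp hs₃
    refine ⟨scalarHom p 2 u₃, hs₃, scalarHom p 2 u₂, hs₂, scalarHom p 2 u₁, hs₁, ?_⟩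
    rw [← hprod, ← map_mul, ← map_mul, ← map_mul, ← map_mul]
    congr 1
    simp only [mul_comm, mul_left_comm]
  exact no_levelOne_design_of_lineTransitive₁₂ (subgroupTPP_reverse htpp) hZ' htrans hh hhZ
    (Reversal.design_reverse H₁ H₂ H₃ hdes)

end LineTransitiveMember

end Summit.MatrixMultiplication.MatrixMultiplication.Theorems.SubgroupIdentityDesigns.Negative

end
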